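import Mathlib
import HarnessLib

/-!
# Continuity of reflection-monotone kernels on `ℝ³ ∖ 0` (the Messager–Miracle-Solé sandwich)

Helper file for item stmt-CriticalPhenomena-1983 (`TwoPointKernelOfLimit`, routes
`GaussianScaleMixture` / `HyperoctahedralRP` of `CriticalPhenomena/Ising3DConformalLimit`).

Pure real analysis, no lattice.  Let `K : ℝ³ → ℝ` satisfy, at every `y ≠ 0`,
* evenness in each coordinate, `K (y - 2yᵢ eᵢ) = K y`;
* axis monotonicity, `K (y + t eᵢ) ≤ K y` for `yᵢ ≥ 0`, `t ≥ 0`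
  (Messager–Miracle-Solé / Hegerfeldt, Thm. 3.1, in the limit);
* diagonal monotonicity, `K (y + t (eᵢ - eⱼ)) ≤ K y` for `yⱼ ≤ yᵢ`, `t ≥ 0`
  (Hegerfeldt, Thm. 3.2, in the limit);
and let `c ↦ K (c • x)` be continuous at `c = 1` (e.g. `K` homogeneous).  Then `K` is continuous
at `x ≠ 0` (`continuousAt_of_mms`).

Proof (the "orthant sandwich").  By evenness `K y = K |y|` (coordinatewise absolute values), so
one may assume `x, y ≥ 0`; by a coordinate permutation (supplied by the caller) `x₀` is the largest
coordinate.  Every point `w ≥ 0` can be reached from a point `z ≥ 0` with `z₀ = max z` by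
K-non-increasing moves — transfers `t (e₀ - eⱼ)` of the excess `max (zⱼ - wⱼ) 0` to the `0`-th
coordinate followed by coordinate raises — as soon as `w₀ ≥ z₀ + Σⱼ max (zⱼ - wⱼ) 0`
(`apply_le_of_transfer_raise`).  Applied to `z = (1 - 3η/x₀) x`, `w = |y|` it gives
`K y ≤ K ((1 - 3η/x₀) x)`, and applied to `z = |y| + 2η e₀`, `w = (1 + 5η/x₀) x` it gives
`K ((1 + 5η/x₀) x) ≤ K y`, for `‖y - x‖ ≤ η ≤ x₀/6`; ray continuity at `c = 1` concludes.

References: A. Messager, S. Miracle-Solé, J. Stat. Phys. 17 (1977) 245–262; G. C. Hegerfeldt,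
Comm. Math. Phys. 57 (1977) 259–266, Thms. 3.1, 3.2.
-/

noncomputable section

open Filter Topology

namespace Summit.CriticalPhenomena.Ising3DConformalLimit.Theorems.TwoPointKernel

local notation "E3" => EuclideanSpace ℝ (Fin 3)

/-- The unit coordinate vectors of `ℝ³` (local notation `𝐞 i`). -/
local notation "𝐞" => fun (i : Fin 3) => (EuclideanSpace.single i (1 : ℝ) : EuclideanSpace ℝ (Fin 3))

variable {K : E3 → ℝ}

/-! ### Elementary facts on `ℝ³` -/

/-- A coordinate is bounded by the Euclidean norm: `|yᵢ| ≤ ‖y‖`. -/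
theorem abs_apply_le_norm (y : E3) (i : Fin 3) : |y i| ≤ ‖y‖ := by
  have h := abs_real_inner_le_norm (EuclideanSpace.single i (1:ℝ)) y
  rw [EuclideanSpace.inner_single_left] at h
  simpa using h

/-- A vector of `ℝ³` dominating coordinatewise a nonzero nonnegative vector is nonzero. -/
theorem ne_zero_of_le {u v : E3} (hu : u ≠ 0) (hu0 : ∀ i, 0 ≤ u i) (huv : ∀ i, u i ≤ v i) :
    v ≠ 0 := by
  intro hv
  apply hu
  ext i
  have h1 := hu0 i
  have h2 := huv i
  rw [hv] at h2
  simp only [PiLp.zero_apply] at h2 ⊢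
  linarith

/-- A vector with a nonzero coordinate is nonzero. -/
theorem ne_zero_of_apply_ne_zero {u : E3} {i : Fin 3} (h : u i ≠ 0) : u ≠ 0 := by
  intro hu
  rw [hu] at h
  exact h rfl

/-! ### Moves that do not increase `K` -/

section Moves

variable (hA : ∀ y : E3, y ≠ 0 → ∀ i : Fin 3, 0 ≤ y i → ∀ t : ℝ, 0 ≤ t →
    K (y + t • EuclideanSpace.single i (1:ℝ)) ≤ K y)

include hA in
/-- **Raising coordinates does not increase `K`**: if `0 ≤ u ≤ w` coordinatewise and `u ≠ 0`
then `K w ≤ K u` (three axis moves). -/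
theorem apply_le_of_le {u w : E3} (hu : u ≠ 0) (hu0 : ∀ i, 0 ≤ u i) (huw : ∀ i, u i ≤ w i) :
    K w ≤ K u := by
  -- the three intermediate points
  set q1 : E3 := u + (w 0 - u 0) • 𝐞 0 with hq1
  set q2 : E3 := q1 + (w 1 - u 1) • 𝐞 1 with hq2
  set q3 : E3 := q2 + (w 2 - u 2) • 𝐞 2 with hq3
  have hq1c : ∀ i, q1 i = if i = 0 then w 0 else u i := by
    intro i; fin_cases i <;> simp [hq1]
  have hq2c : ∀ i, q2 i = if i = 2 then u 2 else w i := by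
    intro i; fin_cases i <;> simp [hq2, hq1]
  have hq3w : q3 = w := by
    ext i; fin_cases i <;> simp [hq3, hq2, hq1]
  have hq1ge : ∀ i, u i ≤ q1 i := fun i => by
    rw [hq1c]; split_ifs with h
    · subst h; exact huw 0
    · exact le_rfl
  have hq2ge : ∀ i, u i ≤ q2 i := fun i => by
    rw [hq2c]; split_ifs with h
    · subst h; exact le_rfl
    · exact huw i
  have hq1ne : q1 ≠ 0 := ne_zero_of_le hu hu0 hq1ge
  have hq2ne : q2 ≠ 0 := ne_zero_of_le hu hu0 hq2ge
  have s1 : K q1 ≤ K u := hA u hu 0 (hu0 0) _ (sub_nonneg.2 (huw 0))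
  have s2 : K q2 ≤ K q1 :=
    hA q1 hq1ne 1 (by rw [hq1c]; simpa using hu0 1) _ (sub_nonneg.2 (huw 1))
  have s3 : K q3 ≤ K q2 :=
    hA q2 hq2ne 2 (by rw [hq2c]; simpa using hu0 2) _ (sub_nonneg.2 (huw 2))
  rw [hq3w] at s3
  exact s3.trans (s2.trans s1)

variable (hD : ∀ y : E3, y ≠ 0 → ∀ i j : Fin 3, i ≠ j → y j ≤ y i → ∀ t : ℝ, 0 ≤ t →
    K (y + t • (EuclideanSpace.single i (1:ℝ) - EuclideanSpace.single j (1:ℝ))) ≤ K y)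

include hA hD in
/-- **Transfer-then-raise**: let `z ≥ 0`, `z ≠ 0`, with `z₀` its largest coordinate, and let
`w ≥ 0` with `w₀ ≥ z₀ + max (z₁ - w₁) 0 + max (z₂ - w₂) 0`.  Then `K w ≤ K z`: transfer the
excesses `max (zⱼ - wⱼ) 0` (`j = 1, 2`) to the `0`-th coordinate along `e₀ - eⱼ` (diagonal moves,
legal since `z₀` stays the largest coordinate), then raise every coordinate to `w`. -/
theorem apply_le_of_transfer_raise {z w : E3} (hz : z ≠ 0) (hz0 : ∀ i, 0 ≤ z i)
    (hw0 : ∀ i, 0 ≤ w i) (hz1 : z 1 ≤ z 0) (hz2 : z 2 ≤ z 0)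
    (hw : z 0 + max (z 1 - w 1) 0 + max (z 2 - w 2) 0 ≤ w 0) : K w ≤ K z := by
  set t1 : ℝ := max (z 1 - w 1) 0 with ht1
  set t2 : ℝ := max (z 2 - w 2) 0 with ht2
  have ht1n : 0 ≤ t1 := le_max_right _ _
  have ht2n : 0 ≤ t2 := le_max_right _ _
  -- `z₀ > 0`
  have hz00 : 0 < z 0 := by
    by_contra h
    push Not at h
    apply hz
    ext i
    fin_cases i <;> simp <;> linarith [hz0 0, hz0 1, hz0 2]
  set p1 : E3 := z + t1 • (𝐞 0 - 𝐞 1) with hp1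
  set p2 : E3 := p1 + t2 • (𝐞 0 - 𝐞 2) with hp2
  have hp1_0 : p1 0 = z 0 + t1 := by simp [hp1]
  have hp1_1 : p1 1 = z 1 - t1 := by simp [hp1, sub_eq_add_neg]
  have hp1_2 : p1 2 = z 2 := by simp [hp1]
  have hp2_0 : p2 0 = z 0 + t1 + t2 := by simp [hp2, hp1]
  have hp2_1 : p2 1 = z 1 - t1 := by simp [hp2, hp1, sub_eq_add_neg]
  have hp2_2 : p2 2 = z 2 - t2 := by simp [hp2, hp1, sub_eq_add_neg]
  have hp1ne : p1 ≠ 0 := ne_zero_of_apply_ne_zero (i := 0) (by rw [hp1_0]; linarith)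
  have hp2ne : p2 ≠ 0 := ne_zero_of_apply_ne_zero (i := 0) (by rw [hp2_0]; linarith)
  -- the two transfers
  have s1 : K p1 ≤ K z := hD z hz 0 1 (by decide) hz1 t1 ht1n
  have s2 : K p2 ≤ K p1 :=
    hD p1 hp1ne 0 2 (by decide) (by rw [hp1_0, hp1_2]; linarith) t2 ht2n
  -- the final raise
  have hmin1 : z 1 - t1 ≤ w 1 ∧ 0 ≤ z 1 - t1 := by
    rw [ht1]
    rcases le_total (z 1 - w 1) 0 with h | h
    · rw [max_eq_right h]; constructor <;> linarith [hz0 1]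
    · rw [max_eq_left h]; constructor <;> linarith [hw0 1]
  have hmin2 : z 2 - t2 ≤ w 2 ∧ 0 ≤ z 2 - t2 := by
    rw [ht2]
    rcases le_total (z 2 - w 2) 0 with h | h
    · rw [max_eq_right h]; constructor <;> linarith [hz0 2]
    · rw [max_eq_left h]; constructor <;> linarith [hw0 2]
  have hp2nn : ∀ i, 0 ≤ p2 i := by
    intro i
    fin_cases i
    · change 0 ≤ p2 0; rw [hp2_0]; linarith
    · change 0 ≤ p2 1; rw [hp2_1]; exact hmin1.2
    · change 0 ≤ p2 2; rw [hp2_2]; exact hmin2.2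
  have hp2le : ∀ i, p2 i ≤ w i := by
    intro i
    fin_cases i
    · change p2 0 ≤ w 0; rw [hp2_0]; exact hw
    · change p2 1 ≤ w 1; rw [hp2_1]; exact hmin1.1
    · change p2 2 ≤ w 2; rw [hp2_2]; exact hmin2.1
  have s3 : K w ≤ K p2 := apply_le_of_le hA hp2ne hp2nn hp2le
  exact s3.trans (s2.trans s1)

end Moves

/-! ### Evenness: `K y = K |y|` -/

section Even

variable (hE : ∀ y : E3, y ≠ 0 → ∀ i : Fin 3,
    K (y - (2 * y i) • EuclideanSpace.single i (1:ℝ)) = K y)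

include hE in
/-- One absolute value: `K (y - (yᵢ - |yᵢ|) eᵢ) = K y` (the move is trivial if `yᵢ ≥ 0` and the
`i`-th reflection otherwise). -/
theorem apply_sub_abs_step {y : E3} (hy : y ≠ 0) (i : Fin 3) :
    K (y - (y i - |y i|) • EuclideanSpace.single i (1:ℝ)) = K y := by
  rcases le_or_gt 0 (y i) with h | h
  · rw [abs_of_nonneg h, sub_self, zero_smul, sub_zero]
  · rw [abs_of_neg h, sub_neg_eq_add, ← two_mul]
    exact hE y hy i

/-- The step `y ↦ y - (yᵢ - |yᵢ|) eᵢ` replaces the `i`-th coordinate by its absolute value. -/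
theorem sub_abs_step_apply (y : E3) (i k : Fin 3) :
    (y - (y i - |y i|) • EuclideanSpace.single i (1:ℝ)) k = if k = i then |y i| else y k := by
  by_cases hk : k = i
  · subst hk; simp
  · simp [hk]

/-- The step preserves non-vanishing. -/
theorem sub_abs_step_ne_zero {y : E3} (hy : y ≠ 0) (i : Fin 3) :
    y - (y i - |y i|) • EuclideanSpace.single i (1:ℝ) ≠ 0 := by
  intro h
  apply hy
  ext k
  have hk := congrArg (fun v : E3 => v k) h
  simp only [sub_abs_step_apply, PiLp.zero_apply] at hk
  by_cases hki : k = i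
  · subst hki
    rw [if_pos rfl] at hk
    simpa using hk
  · rw [if_neg hki] at hk
    simpa using hk

include hE in
/-- **`K y = K |y|`** for `y ≠ 0`, where `|y| = (|y₀|, |y₁|, |y₂|)`. -/
theorem apply_abs_eq {y : E3} (hy : y ≠ 0) :
    K (WithLp.toLp 2 fun k => |y k|) = K y := by
  set y1 : E3 := y - (y 0 - |y 0|) • 𝐞 0 with hy1
  set y2 : E3 := y1 - (y1 1 - |y1 1|) • 𝐞 1 with hy2
  set y3 : E3 := y2 - (y2 2 - |y2 2|) • 𝐞 2 with hy3
  have h1 : ∀ k, y1 k = if k = 0 then |y 0| else y k := sub_abs_step_apply y 0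
  have h2 : ∀ k, y2 k = if k = 1 then |y1 1| else y1 k := sub_abs_step_apply y1 1
  have h3 : ∀ k, y3 k = if k = 2 then |y2 2| else y2 k := sub_abs_step_apply y2 2
  have hy1ne : y1 ≠ 0 := sub_abs_step_ne_zero hy 0
  have hy2ne : y2 ≠ 0 := sub_abs_step_ne_zero hy1ne 1
  have heq : y3 = WithLp.toLp 2 fun k => |y k| := by
    ext k
    fin_cases k
    · change y3 0 = |y 0|
      rw [h3, if_neg (by decide), h2, if_neg (by decide), h1, if_pos rfl]
    · change y3 1 = |y 1|
      rw [h3, if_neg (by decide), h2, if_pos rfl, h1, if_neg (by decide)]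
    · change y3 2 = |y 2|
      rw [h3, if_pos rfl, h2, if_neg (by decide), h1, if_neg (by decide)]
  rw [← heq, hy3, apply_sub_abs_step hE hy2ne 2, hy2, apply_sub_abs_step hE hy1ne 1, hy1,
    apply_sub_abs_step hE hy 0]

end Even

/-! ### The sandwich -/

/-- **Continuity from the Messager–Miracle-Solé structure (normal form).**  If `K` is even in each
coordinate, axis- and diagonal-monotone (away from `0`), continuous along the ray through `x` at
`x`, and `x₀` is a coordinate of largest modulus (`x₀ ≠ 0`), then `K` is continuous at `x`. -/
theorem continuousAt_of_mms_normalForm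
    (hE : ∀ y : E3, y ≠ 0 → ∀ i : Fin 3,
      K (y - (2 * y i) • EuclideanSpace.single i (1:ℝ)) = K y)
    (hA : ∀ y : E3, y ≠ 0 → ∀ i : Fin 3, 0 ≤ y i → ∀ t : ℝ, 0 ≤ t →
      K (y + t • EuclideanSpace.single i (1:ℝ)) ≤ K y)
    (hD : ∀ y : E3, y ≠ 0 → ∀ i j : Fin 3, i ≠ j → y j ≤ y i → ∀ t : ℝ, 0 ≤ t →
      K (y + t • (EuclideanSpace.single i (1:ℝ) - EuclideanSpace.single j (1:ℝ))) ≤ K y)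
    {x : E3} (hR : Tendsto (fun c : ℝ => K (c • x)) (𝓝 1) (𝓝 (K x)))
    (hx0 : x 0 ≠ 0) (hx1 : |x 1| ≤ |x 0|) (hx2 : |x 2| ≤ |x 0|) : ContinuousAt K x := by
  have hxne : x ≠ 0 := ne_zero_of_apply_ne_zero hx0
  set X : ℝ := |x 0| with hX
  have hX0 : 0 < X := abs_pos.2 hx0
  rw [Metric.continuousAt_iff]
  intro ε hε
  obtain ⟨θ, hθ, hθK⟩ := Metric.tendsto_nhds_nhds.1 hR ε hε
  -- the radius
  set η : ℝ := min (X / 6) (θ * X / 6) with hη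
  have hη0 : 0 < η := lt_min (by positivity) (by positivity)
  have hηX : η ≤ X / 6 := min_le_left _ _
  have hηθ : η ≤ θ * X / 6 := min_le_right _ _
  refine ⟨η, hη0, fun y hy => ?_⟩
  rw [dist_eq_norm] at hy
  -- coordinates of `y` are `η`-close to those of `x`
  have hco : ∀ i, |y i - x i| < η := fun i =>
    lt_of_le_of_lt (by simpa using abs_apply_le_norm (y - x) i) hy
  -- the absolute values
  set ax : E3 := WithLp.toLp 2 fun k => |x k| with hax
  set ay : E3 := WithLp.toLp 2 fun k => |y k| with hay
  have hax_apply : ∀ k, ax k = |x k| := fun k => rfl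
  have hay_apply : ∀ k, ay k = |y k| := fun k => rfl
  have hyne : y ≠ 0 := by
    refine ne_zero_of_apply_ne_zero (i := 0) fun h => ?_
    have := hco 0
    rw [h, zero_sub, abs_neg] at this
    linarith
  have hKx : K ax = K x := apply_abs_eq hE hxne
  have hKy : K ay = K y := apply_abs_eq hE hyne
  have hclose : ∀ k, |ay k - ax k| < η := fun k => by
    rw [hay_apply, hax_apply]
    exact (abs_abs_sub_abs_le_abs_sub _ _).trans_lt (hco k)
  have hax0 : ∀ k, 0 ≤ ax k := fun k => abs_nonneg _
  have hay0 : ∀ k, 0 ≤ ay k := fun k => abs_nonneg _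
  have haxX : ax 0 = X := rfl
  have hax1 : ax 1 ≤ X := hx1
  have hax2 : ax 2 ≤ X := hx2
  -- `K (c • x) = K (c • ax)` for `c > 0`
  have hKc : ∀ c : ℝ, 0 < c → K (c • ax) = K (c • x) := by
    intro c hc
    have hcx : c • x ≠ 0 := smul_ne_zero hc.ne' hxne
    rw [← apply_abs_eq hE hcx]
    congr 1
    ext k
    simp [hax_apply, abs_mul, abs_of_pos hc]
  have hKcε : ∀ c : ℝ, 0 < c → |c - 1| < θ → |K (c • ax) - K x| < ε := by
    intro c hc hcθ
    rw [hKc c hc]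
    have := hθK (by rwa [dist_eq_norm, Real.norm_eq_abs])
    rwa [dist_eq_norm, Real.norm_eq_abs] at this
  -- upper bound: `K y ≤ K (c • x)` with `c = 1 - 3η/X`
  set c : ℝ := 1 - 3 * η / X with hc
  have hc0 : 0 < c := by
    rw [hc, sub_pos, div_lt_one hX0]; linarith
  have hcle : c ≤ 1 := by
    rw [hc, sub_le_self_iff]; positivity
  have hcX : c * X = X - 3 * η := by rw [hc]; field_simp
  have hup : K ay ≤ K (c • ax) := by
    refine apply_le_of_transfer_raise hA hD (smul_ne_zero hc0.ne' (ne_zero_of_apply_ne_zero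
      (i := 0) (by rw [haxX]; exact hX0.ne'))) (fun i => ?_) hay0 ?_ ?_ ?_
    · rw [PiLp.smul_apply, smul_eq_mul]; exact mul_nonneg hc0.le (hax0 i)
    · rw [PiLp.smul_apply, PiLp.smul_apply, smul_eq_mul, smul_eq_mul]
      exact mul_le_mul_of_nonneg_left (hax1.trans haxX.symm.le) hc0.le
    · rw [PiLp.smul_apply, PiLp.smul_apply, smul_eq_mul, smul_eq_mul]
      exact mul_le_mul_of_nonneg_left (hax2.trans haxX.symm.le) hc0.le
    · simp only [PiLp.smul_apply, smul_eq_mul]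
      rw [haxX, hcX]
      have m1 : max (c * ax 1 - ay 1) 0 ≤ η := by
        refine max_le ?_ hη0.le
        have h1 : c * ax 1 ≤ ax 1 := mul_le_of_le_one_left (hax0 1) hcle
        have h2 := abs_lt.1 (hclose 1)
        linarith
      have m2 : max (c * ax 2 - ay 2) 0 ≤ η := by
        refine max_le ?_ hη0.le
        have h1 : c * ax 2 ≤ ax 2 := mul_le_of_le_one_left (hax0 2) hcle
        have h2 := abs_lt.1 (hclose 2)
        linarith
      have h0 := abs_lt.1 (hclose 0)
      rw [haxX] at h0
      linarith
  -- lower bound: `K (c' • x) ≤ K y` with `c' = 1 + 5η/X`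
  set c' : ℝ := 1 + 5 * η / X with hc'
  have hc'1 : 1 ≤ c' := by rw [hc']; exact le_add_of_nonneg_right (by positivity)
  have hc'0 : 0 < c' := lt_of_lt_of_le one_pos hc'1
  have hc'X : c' * X = X + 5 * η := by rw [hc']; field_simp
  set z : E3 := ay + (2 * η) • 𝐞 0 with hz
  have hz_0 : z 0 = ay 0 + 2 * η := by simp [hz]
  have hz_1 : z 1 = ay 1 := by simp [hz]
  have hz_2 : z 2 = ay 2 := by simp [hz]
  have hayne : ay ≠ 0 := by
    refine ne_zero_of_apply_ne_zero (i := 0) fun h => ?_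
    have := hclose 0
    rw [h, zero_sub, abs_neg, haxX, abs_of_pos hX0] at this
    linarith
  have hzy : K z ≤ K ay := hA ay hayne 0 (hay0 0) _ (by positivity)
  have hlow : K (c' • ax) ≤ K z := by
    have h0 := abs_lt.1 (hclose 0)
    have h1 := abs_lt.1 (hclose 1)
    have h2 := abs_lt.1 (hclose 2)
    rw [haxX] at h0
    refine apply_le_of_transfer_raise hA hD (ne_zero_of_apply_ne_zero (i := 0)
      (by rw [hz_0]; linarith [hay0 0])) (fun i => ?_) (fun i => ?_) ?_ ?_ ?_
    · fin_cases i
      · change 0 ≤ z 0; rw [hz_0]; linarith [hay0 0]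
      · change 0 ≤ z 1; rw [hz_1]; exact hay0 1
      · change 0 ≤ z 2; rw [hz_2]; exact hay0 2
    · rw [PiLp.smul_apply, smul_eq_mul]; exact mul_nonneg hc'0.le (hax0 i)
    · rw [hz_0, hz_1]; linarith
    · rw [hz_0, hz_2]; linarith
    · simp only [PiLp.smul_apply, smul_eq_mul]
      rw [hz_0, hz_1, hz_2, haxX, hc'X]
      have m1 : max (ay 1 - c' * ax 1) 0 ≤ η := by
        refine max_le ?_ hη0.le
        have : ax 1 ≤ c' * ax 1 := le_mul_of_one_le_left (hax0 1) hc'1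
        linarith
      have m2 : max (ay 2 - c' * ax 2) 0 ≤ η := by
        refine max_le ?_ hη0.le
        have : ax 2 ≤ c' * ax 2 := le_mul_of_one_le_left (hax0 2) hc'1
        linarith
      linarith
  -- conclusion
  have hθc : |c - 1| < θ := by
    rw [hc, sub_sub_cancel_left, abs_neg, abs_of_pos (by positivity)]
    rw [div_lt_iff₀ hX0]
    linarith
  have hθc' : |c' - 1| < θ := by
    rw [hc', add_sub_cancel_left, abs_of_pos (by positivity)]
    rw [div_lt_iff₀ hX0]
    linarith
  have hu := abs_lt.1 (hKcε c hc0 hθc)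
  have hl := abs_lt.1 (hKcε c' hc'0 hθc')
  rw [dist_eq_norm, Real.norm_eq_abs, abs_lt, ← hKy]
  constructor
  · linarith [hlow.trans hzy]
  · linarith [hup]

end Summit.CriticalPhenomena.Ising3DConformalLimit.Theorems.TwoPointKernel

end
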